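import Summits.NavierStokesRegularity.NavierStokesRegularity.Theorems.TaoLadderRungTwoFlatCoMovingEnergyDecay
import HarnessLib

/-!
# ZONE GEOMETRY 54 — the behind zone of `H(n)` versus `ε₀` (TRAP-CANDIDATE #9; kill point (K8) BEHIND SLOSH;
  ruling R54-1/R54-2; ERRATUM-54) — cell harvest/h2-tao-ladder, theory-1 g42, numT54; LADDER §54

PROVENANCE (p1 g22): theory-1 g42's image of record numT54/ZoneGeometry54.lean sha16 58fc98781fe4b76d (farm `lean check` rc 0 · 0 sorry · 0 warnings),
landed with declarations BYTE-IDENTICAL + lint docstrings (three added: `ofState_apply`, `behindBlock_mono`, `behindEnergy_nonneg`; five cite keys re-headed with a bib key / `folklore`) (helper for the K_A♭ parent item stmt-NavierStokesRegularity-22987); the image's module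
docstring follows verbatim.

Child 2A `GradedAdiabaticWakeA` of the K_A♭ split of route TaoLadderRungTwoFlat is proved through p1's typed frame
`H(n)` (`…Theorems.HopTube`): a product tube `InTube n = Anchor ∧ Core ∧ Near ∧ Behind ∧ Ahead` and one forward-
invariance obligation per zone. This file is theory-1's typed companion of the memo `numT54/ZONE-GEOMETRY-54.md`:

(K8) BEHIND SLOSH. The obligation `TubeStepBehind n` (sup envelope `|z_k| ≤ A n·(1+ε₀)^{θ_b·min(|k|, n+K₂)}` is
re-established at `n+1` for EVERY tube state) is unprovable for small `ε₀`: on the ALIVE band `K < |k| < d_*(ε₀)`,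
`d_*(ε₀) ≈ ln(C/ε₀)/((5/2−θ_b)·ln(1+ε₀))`, two adjacent envelope-saturated shells exchange an `O(A·τ)` FRACTION of their
energy within one hop (the lattice is quadratic, the flux is an odd cubic whose sign the state chooses), while the
clause tolerates per hop only the factor `(1+c')·(1+ε₀)^{θ_b} ≤ (1+c')(1+θ_b ε₀)` (`slosh_necessary`,
`hop_allowance_le`: index shift + schedule growth; `c' = C'δ n`). A sup envelope is not transport-invariant.

R54-1 (BEHIND := WEIGHTED ENERGY + CAP). Replace the sup envelope by
(B1) `BehindEnergyClause`: for every depth `L`, the co-moving energy of the state ITSELF (template `0`) on the block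
`[-K-L, -K-1]` with the SLOW exponent `θ' = 2θ_b'·ln(1+ε₀)` is `≤ W n` — transport-invariant by p1's landed
`MirrorPulse.coMovingEnergyOn_decay_of_pseudoFlows` with `M = 0`, rate `μ = θ'(σ − (1+ε)c̄A_eff) > 0` iff the
CLOCK-WEIGHTED amplitude `A_eff = sup clock·|u| < σ/((1+ε)c̄)` (`clockWeighted_le_one`: the derived sup
`√(2W)·(1+ε₀)^{θ_b' d}` times the clock `(1+ε₀)^{-5d/2}` never exceeds `√(2W)`), margin `1 − √3/2 > 0.1339` at the
(JB) junk level (`transport_margin`, wider than (K2)'s `0.097`); sup extraction `abs_le_of_behindEnergyClause`;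
(B2) `BehindCapClause`: a crude uniform cap `|z_k| ≤ Λ n` behind (Gronwall-invariant, `Λ` may depend on anything) —
it alone carries the boundedness of tube states (`inTube_bounded`). Transient bookkeeping: `le_exp_sum_mul_of_step`
(discrete Gronwall with summable rates: the core's geometric transient `δ̄ρ'^n` feeds `W` through the top bond with
`Σ g_n < ∞`, `ε₀`-free); kicks: `kick_weight_sum_le`.

R54-2 / ERRATUM-54 (THREE DEPTHS). The letter `D` of numT50/numT52 named three different depths: the ENTRY depth
`D₀` (ε₀-free; fixes `N₀` through (WG) at `(K + D₀, δ₁)`), the NEAR-BLOCK depth `D_near(ε₀) ~ (2/θ_V)ln(1/ε₀)` (bottom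
discount), and the FREEZING depth `d_*(ε₀) ~ (1/2ε₀)ln(1/ε₀)` (used by no clause under R54-1). The entry near budget
is `v̄ ≤ v_top + e^{-θ_V D₀}·E_(JB)` (`entry_near_budget`, `deep_discount_le`), so `N₀` stays `ε₀`-free.

HONEST FRAMING: MODEL lattice (graded mirror table on `S♭`, `m = 2`); elementary real-analysis bookkeeping about the
cell's typed induction frame; floats of the memo unsealed; nothing certified; no item moved; nothing about the
Navier–Stokes equations.
-/

noncomputable section

-- the sub-problem namespace repeats the summit name by design (D-0017)
set_option linter.dupNamespace false

namespace Summit.NavierStokesRegularity.NavierStokesRegularity.Theorems.HopTube.R54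

open Set Finset Literature.Analysis.FluidPDE Literature.Analysis.FluidPDE.TaoCascade

/-! ## 1. The re-typed behind clauses (R54-1) -/

/-- A state read as a time-constant trajectory (so that p1's `MirrorPulse.coMovingEnergyOn` applies to states).
[folklore; cell LADDER §54] -/
def ofState (z : Fin 2 → ℤ → ℝ) : Fin 2 → ℤ → ℝ → ℝ := fun i k _ => z i k

/-- `ofState z` read at any time is `z`. [folklore; cell LADDER §54 (R54-1)] -/
@[simp] theorem ofState_apply (z : Fin 2 → ℤ → ℝ) (i : Fin 2) (k : ℤ) (t : ℝ) : ofState z i k t = z i k := rfl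

/-- The behind block of depth `L` below the window bottom `-K`: shells `-K-L … -K-1`. [cite: Tao2016AveragedNS, §6.3–6.4 (statement shape); cell LADDER §54 (R54-1)] -/
def behindBlock (K L : ℕ) : Finset ℤ := Finset.Icc (-(K : ℤ) - L) (-(K : ℤ) - 1)

/-- (B1) data: the weighted behind energy of depth `L`, `W_L(z) = Σ_{k=-K-L}^{-K-1} e^{θ'(k+K)}·Σ_i z_{ik}²/2`
(co-moving energy of the state itself, template `0`, reference point `-K`). [cite: Tao2016AveragedNS, §4 (4.3) (energy); cell LADDER §54 (R54-1)] -/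
def behindEnergy (K L : ℕ) (θ' : ℝ) (z : Fin 2 → ℤ → ℝ) : ℝ :=
  MirrorPulse.coMovingEnergyOn (behindBlock K L) θ' (-(K : ℝ)) (ofState z) 0

/-- **(B1) BEHIND ENERGY CLAUSE**: every finite behind block has weighted energy `≤ W n` (equivalently the
infinite weighted sum is `≤ W n`; stated block-wise to stay inside `Finset` sums). A predicate; nothing asserted.
[cite: Tao2016AveragedNS, §4 (4.3) (energy), §6.2 Prop. 6.3 (statement shape of the checkpoint description); cell LADDER §54 (R54-1)] -/
def BehindEnergyClause (K : ℕ) (θ' Wn : ℝ) (z : Fin 2 → ℤ → ℝ) : Prop := ∀ L : ℕ, behindEnergy K L θ' z ≤ Wn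

/-- **(B2) BEHIND CAP CLAUSE**: a uniform (in `k`) sup cap behind the window — the only source of boundedness of
tube states under R54-1; `Λ` may depend on `ε₀` and `n`. A predicate; nothing asserted.
[cite: Tao2016AveragedNS, §6.2 Prop. 6.3 (statement shape, boundedness clause (4.5)); cell LADDER §54 (R54-1)] -/
def BehindCapClause (K : ℕ) (Λ : ℝ) (z : Fin 2 → ℤ → ℝ) : Prop := ∀ (i : Fin 2) (k : ℤ), k < -(K : ℤ) → |z i k| ≤ Λ

/-- Deeper behind blocks contain shallower ones. [folklore; cell LADDER §54 (R54-1)] -/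
theorem behindBlock_mono (K : ℕ) {L L' : ℕ} (h : L ≤ L') : behindBlock K L ⊆ behindBlock K L' := by
  intro k hk
  simp only [behindBlock, Finset.mem_Icc] at hk ⊢
  have : (L : ℤ) ≤ L' := by exact_mod_cast h
  exact ⟨by linarith [hk.1], hk.2⟩

/-- The block energies increase with the depth (so (B1) is the bound on their supremum). [cite: Tao2016AveragedNS, §4 (4.3); cell LADDER §54] -/
theorem behindEnergy_mono (K : ℕ) {L L' : ℕ} (h : L ≤ L') (θ' : ℝ) (z : Fin 2 → ℤ → ℝ) :
    behindEnergy K L θ' z ≤ behindEnergy K L' θ' z :=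
  MirrorPulse.coMovingEnergyOn_mono (behindBlock_mono K h) θ' _ _ _

/-- The behind block energy is nonnegative. [cite: Tao2016AveragedNS, §4 (4.3); cell LADDER §54] -/
theorem behindEnergy_nonneg (K L : ℕ) (θ' : ℝ) (z : Fin 2 → ℤ → ℝ) : 0 ≤ behindEnergy K L θ' z :=
  MirrorPulse.coMovingEnergyOn_nonneg _ _ _ _ _

/-- **SUP EXTRACTION FROM (B1)**, squared form: `z_{ik}²/2 ≤ e^{θ'(−K−k)}·W n` for every behind shell `k < -K`.
[cite: Tao2016AveragedNS, §4 (4.3); cell LADDER §54 (L-54a)] -/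
theorem sq_le_of_behindEnergyClause {K : ℕ} {θ' Wn : ℝ} {z : Fin 2 → ℤ → ℝ}
    (h : BehindEnergyClause K θ' Wn z) (i : Fin 2) {k : ℤ} (hk : k < -(K : ℤ)) :
    z i k ^ 2 / 2 ≤ Real.exp (θ' * (-(K : ℝ) - k)) * Wn := by
  obtain ⟨L, hL⟩ : ∃ L : ℕ, (L : ℤ) = -(K : ℤ) - k := ⟨(-(K : ℤ) - k).toNat, Int.toNat_of_nonneg (by omega)⟩
  have hmem : k ∈ behindBlock K L := by
    simp only [behindBlock, Finset.mem_Icc]; omega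
  have h1 := MirrorPulse.sq_le_exp_mul_coMovingEnergyOn (behindBlock K L) θ' (-(K : ℝ)) (ofState z) 0 hmem i
  simp only [ofState_apply] at h1
  exact h1.trans (mul_le_mul_of_nonneg_left (h L) (Real.exp_pos _).le)

/-- **SUP EXTRACTION FROM (B1)**: `|z_{ik}| ≤ √(2 W n)·e^{θ'(−K−k)/2}` behind the window (L-54a: the a-priori
amplitude the near/core obligations and the thresholds consume under R54-1). [cite: Tao2016AveragedNS, §4 (4.3); cell LADDER §54 (L-54a)] -/
theorem abs_le_of_behindEnergyClause {K : ℕ} {θ' Wn : ℝ} {z : Fin 2 → ℤ → ℝ} (hW : 0 ≤ Wn)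
    (h : BehindEnergyClause K θ' Wn z) (i : Fin 2) {k : ℤ} (hk : k < -(K : ℤ)) :
    |z i k| ≤ Real.sqrt (2 * Wn) * Real.exp (θ' * (-(K : ℝ) - k) / 2) := by
  have h1 := sq_le_of_behindEnergyClause h i hk
  have hsq : Real.exp (θ' * (-(K : ℝ) - k) / 2) ^ 2 = Real.exp (θ' * (-(K : ℝ) - k)) := by
    rw [sq, ← Real.exp_add, add_halves]
  have h2 : z i k ^ 2 ≤ (Real.sqrt (2 * Wn) * Real.exp (θ' * (-(K : ℝ) - k) / 2)) ^ 2 := by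
    rw [mul_pow, Real.sq_sqrt (by linarith), hsq]; linarith
  exact abs_le.mpr (abs_le_of_sq_le_sq' h2 (by positivity))

/-! ## 2. Clock-weighted amplitude and the transport margin (why (B1) is hop-invariant) -/

/-- `e^{θ' d/2} = (1+ε₀)^{θ_b' d}` for the slow exponent `θ' = 2θ_b'·ln(1+ε₀)`. [folklore; cell LADDER §54] -/
theorem exp_half_mul_eq_rpow {ε₀ θb' d : ℝ} (hε₀ : 0 < 1 + ε₀) :
    Real.exp (2 * θb' * Real.log (1 + ε₀) * d / 2) = (1 + ε₀) ^ (θb' * d) := by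
  rw [Real.rpow_def_of_pos hε₀]; congr 1; ring

/-- **CLOCK × DERIVED SUP ≤ √(2W)**: at depth `d ≥ 0` the clock `(1+ε₀)^{-5d/2}` times the growth `(1+ε₀)^{θ_b' d}` of the
(B1)-derived sup is `≤ 1` whenever `θ_b' ≤ 5/2` — the clock-weighted amplitude that enters the flux bound is uniformly
`≤ √(2 W n)`, however deep and large the state is. [cite: Tao2016AveragedNS, §4 (4.3) (clocks `λ^{5n/2}`); cell LADDER §54 (L-54b)] -/
theorem clockWeighted_le_one {ε₀ θb' d : ℝ} (hε₀ : 0 ≤ ε₀) (hθ : θb' ≤ 5 / 2) (hd : 0 ≤ d) :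
    (1 + ε₀) ^ (-(5 / 2 : ℝ) * d) * (1 + ε₀) ^ (θb' * d) ≤ 1 := by
  rw [← Real.rpow_add (by linarith)]
  exact Real.rpow_le_one_of_one_le_of_nonpos (by linarith) (by nlinarith)

/-- **TRANSPORT MARGIN AT THE (JB) LEVEL**: with the junk amplitude `A = √3·σ/(2(1+ε))` of record
(`MirrorPulse.two_mul_sqrt_junkThreshold`) and clocks `c̄ = 1`, the slow-exponent rate
`μ/θ' = σ − (1+ε)c̄A = σ(1 − √3/2)` is positive with margin `> 0.1339·σ`. [folklore (numerical inequality); cell LADDER §49.4, §54 ((K8'))] -/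
theorem transport_margin : (0.1339 : ℝ) < 1 - Real.sqrt 3 / 2 := by
  have h3 : Real.sqrt 3 < 1.7321 := by
    rw [Real.sqrt_lt' (by norm_num)]; norm_num
  linarith

/-- The slow-exponent transport margin `1 − √3/2` is WIDER than (K2)'s margin `1 − √3·sinh(1/2)` at `θ_V = 1`
(`MirrorPulse.race_margin_at_one`): (B1)'s invariance asks less of the junk than the near zone already does.
[folklore (numerical inequality); cell LADDER §49.4, §54] -/
theorem transport_margin_gt_race_margin : 1 - Real.sqrt 3 * Real.sinh (1 / 2) < 1 - Real.sqrt 3 / 2 := by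
  have hs : (1 / 2 : ℝ) < Real.sinh (1 / 2) := Real.self_lt_sinh_iff.mpr (by norm_num)
  have h3 : 0 < Real.sqrt 3 := Real.sqrt_pos.mpr (by norm_num)
  nlinarith

/-! ## 3. (K8) BEHIND SLOSH — what the old sup envelope tolerates per hop -/

/-- Bernoulli: the index shift grants at most `(1+ε₀)^s − 1 ≤ s·ε₀` per hop (`0 ≤ s ≤ 1`). [folklore (Bernoulli); cell LADDER §54 ((K8))] -/
theorem hop_allowance_le {ε₀ s : ℝ} (hε₀ : 0 ≤ ε₀) (hs0 : 0 ≤ s) (hs1 : s ≤ 1) :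
    (1 + ε₀) ^ s - 1 ≤ s * ε₀ := by
  have := rpow_one_add_le_one_add_mul_self (by linarith : (-1 : ℝ) ≤ ε₀) hs0 hs1
  linarith

/-- **(K8) NECESSARY CONDITION.** If a behind shell at depth `d` is envelope-saturated at hop `n`
(`|z| = A·(1+ε₀)^{θ_b d}`), the ratio obeys `a ≤ 1`, and the schedule grows by at most `1 + c'`, then the old
`BehindClause` at hop `n+1` (new depth `d+1`, value `y` of the same lattice shell at the checkpoint, `|y|/a ≤ A'·(1+ε₀)^{θ_b(d+1)}`)
FORCES `|y| ≤ (1+c')(1+θ_b ε₀)·|z|`: a per-hop amplitude gain above `(1+c')(1+θ_b ε₀) = 1 + O(δ n + ε₀)` refutes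
`TubeStepBehind n`. Alive saturated neighbours produce gains `1 + O(A τ)` (memo §1). [cite: Tao2016AveragedNS, §6.3–6.4 (statement shape); cell LADDER §54 ((K8) BEHIND SLOSH)] -/
theorem slosh_necessary {ε₀ θb d a A A' c' y z : ℝ} (hε₀ : 0 ≤ ε₀) (hθ0 : 0 ≤ θb) (hθ1 : θb ≤ 1)
    (hA : 0 ≤ A) (ha0 : 0 < a) (ha1 : a ≤ 1) (hc' : 0 ≤ c') (hA' : A' ≤ A * (1 + c'))
    (hz : |z| = A * (1 + ε₀) ^ (θb * d))
    (hy : |y| / a ≤ A' * (1 + ε₀) ^ (θb * (d + 1))) :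
    |y| ≤ (1 + c') * (1 + θb * ε₀) * |z| := by
  have hP : 0 ≤ (1 + ε₀) ^ (θb * d) := Real.rpow_nonneg (by linarith) _
  have hPb : 0 ≤ (1 + ε₀) ^ θb := Real.rpow_nonneg (by linarith) _
  have hpow : (1 + ε₀) ^ (θb * (d + 1)) = (1 + ε₀) ^ (θb * d) * (1 + ε₀) ^ θb := by
    rw [← Real.rpow_add (by linarith)]; ring_nf
  have hB : (1 + ε₀) ^ θb ≤ 1 + θb * ε₀ := by
    have := rpow_one_add_le_one_add_mul_self (by linarith : (-1 : ℝ) ≤ ε₀) hθ0 hθ1; linarith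
  have hX0 : 0 ≤ A' * (1 + ε₀) ^ (θb * (d + 1)) := le_trans (div_nonneg (abs_nonneg y) ha0.le) hy
  have h1 : |y| ≤ A' * (1 + ε₀) ^ (θb * (d + 1)) := by
    have h := (div_le_iff₀ ha0).mp hy
    calc |y| ≤ A' * (1 + ε₀) ^ (θb * (d + 1)) * a := h
      _ ≤ A' * (1 + ε₀) ^ (θb * (d + 1)) * 1 := mul_le_mul_of_nonneg_left ha1 hX0
      _ = _ := mul_one _
  calc |y| ≤ A' * (1 + ε₀) ^ (θb * (d + 1)) := h1
    _ = A' * ((1 + ε₀) ^ (θb * d) * (1 + ε₀) ^ θb) := by rw [hpow]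
    _ ≤ A * (1 + c') * ((1 + ε₀) ^ (θb * d) * (1 + ε₀) ^ θb) :=
        mul_le_mul_of_nonneg_right hA' (mul_nonneg hP hPb)
    _ ≤ A * (1 + c') * ((1 + ε₀) ^ (θb * d) * (1 + θb * ε₀)) := by
        apply mul_le_mul_of_nonneg_left _ (by positivity)
        exact mul_le_mul_of_nonneg_left hB hP
    _ = (1 + c') * (1 + θb * ε₀) * (A * (1 + ε₀) ^ (θb * d)) := by ring
    _ = (1 + c') * (1 + θb * ε₀) * |z| := by rw [hz]

/-! ## 4. Schedules: summable-rate transient (top bond) and kicks -/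

/-- **DISCRETE GRONWALL WITH SUMMABLE RATES** (the `W`-schedule through the core's geometric transient):
`W(n+1) ≤ (1 + g n)·W n + I n` with `g, I ≥ 0` gives `W n ≤ exp(Σ_{j<n} g j)·(W 0 + Σ_{j<n} I j)`. With
`g n = 2c̄|α|τ·b^K·δ̄ρ'^n` the factor is `exp(2c̄|α|τ b^K δ̄/(1−ρ'))`, ε₀-free. [folklore (discrete Gronwall); cell LADDER §54 (L-54d)] -/
theorem le_exp_sum_mul_of_step {W g I : ℕ → ℝ} (hW : ∀ n, 0 ≤ W n) (hg : ∀ n, 0 ≤ g n) (hI : ∀ n, 0 ≤ I n)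
    (hstep : ∀ n, W (n + 1) ≤ (1 + g n) * W n + I n) :
    ∀ n, W n ≤ Real.exp (∑ j ∈ Finset.range n, g j) * (W 0 + ∑ j ∈ Finset.range n, I j) := by
  intro n
  induction n with
  | zero => simp
  | succ n ih =>
    rw [Finset.sum_range_succ, Finset.sum_range_succ, Real.exp_add]
    set E := Real.exp (∑ j ∈ Finset.range n, g j) with hEdef
    set SI := ∑ j ∈ Finset.range n, I j with hSIdef
    have hE : 1 ≤ E := Real.one_le_exp (Finset.sum_nonneg fun j _ => hg j)
    have hg1 : 1 + g n ≤ Real.exp (g n) := by linarith [Real.add_one_le_exp (g n)]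
    have hSI : 0 ≤ SI := Finset.sum_nonneg fun j _ => hI j
    have hW0 := hW 0
    calc W (n + 1) ≤ (1 + g n) * W n + I n := hstep n
      _ ≤ (1 + g n) * (E * (W 0 + SI)) + I n := by
          have := mul_le_mul_of_nonneg_left ih (by linarith [hg n] : 0 ≤ 1 + g n); linarith
      _ ≤ Real.exp (g n) * (E * (W 0 + SI)) + E * Real.exp (g n) * I n := by
          have h1 : (1 + g n) * (E * (W 0 + SI)) ≤ Real.exp (g n) * (E * (W 0 + SI)) :=
            mul_le_mul_of_nonneg_right hg1 (mul_nonneg (by linarith) (by linarith))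
          have h2 : I n ≤ E * Real.exp (g n) * I n := by
            have h3 : 1 ≤ E * Real.exp (g n) := one_le_mul_of_one_le_of_one_le hE (by linarith [hg n])
            nlinarith [hI n]
          linarith
      _ = E * Real.exp (g n) * (W 0 + (SI + I n)) := by ring

/-- **KICK ENERGY IN (B1)**: a kick of size `≤ r/C` on every behind shell adds to `√W` at most `(r/C)·√(q/(1−q))`,
`q = e^{-θ'}`: the weights' partial sums are `Σ_{d=1}^{L} q^d ≤ q/(1−q)` uniformly in `L` (`≈ 1/(2θ_b' ε₀)`, harmless
for `r = r₁θ₀ε₀^p`, `p ≥ 1`). [folklore (geometric series); cell LADDER §54] -/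
theorem kick_weight_sum_le {q : ℝ} (hq0 : 0 ≤ q) (hq1 : q < 1) (L : ℕ) :
    ∑ d ∈ Finset.Ico 1 (L + 1), q ^ d ≤ q / (1 - q) := by
  simpa using geom_sum_Ico_le_of_lt_one hq0 hq1 (m := 1) (n := L + 1)

/-! ## 5. ERRATUM-54 / R54-2: the entry near budget from (WG) on the top shells and (JB) below -/

/-- Weighted ≤ (largest weight) × plain energy on a set of shells all at index `≤ m` (`θ ≥ 0`). [cite: Tao2016AveragedNS, §4 (4.3); cell LADDER §54 (L-54c)] -/
theorem coMovingEnergyOn_le_exp_mul_energy (s : Finset ℤ) {θ ne m : ℝ} (hθ : 0 ≤ θ)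
    (u : Fin 2 → ℤ → ℝ → ℝ) (t : ℝ) (hs : ∀ n ∈ s, (n : ℝ) ≤ m) :
    MirrorPulse.coMovingEnergyOn s θ ne u t
      ≤ Real.exp (θ * (m - ne)) * ∑ n ∈ s, (u 0 n t ^ 2 + u 1 n t ^ 2) / 2 := by
  unfold MirrorPulse.coMovingEnergyOn
  rw [Finset.mul_sum]
  refine Finset.sum_le_sum fun n hn => ?_
  apply mul_le_mul_of_nonneg_right _ (by positivity)
  exact Real.exp_le_exp.mpr (mul_le_mul_of_nonneg_left (by linarith [hs n hn]) hθ)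

/-- The co-moving energy is additive over disjoint sets of shells. [folklore; cell LADDER §54] -/
theorem coMovingEnergyOn_union {s₁ s₂ : Finset ℤ} (h : Disjoint s₁ s₂) (θ ne : ℝ)
    (u : Fin 2 → ℤ → ℝ → ℝ) (t : ℝ) :
    MirrorPulse.coMovingEnergyOn (s₁ ∪ s₂) θ ne u t
      = MirrorPulse.coMovingEnergyOn s₁ θ ne u t + MirrorPulse.coMovingEnergyOn s₂ θ ne u t := by
  unfold MirrorPulse.coMovingEnergyOn; exact Finset.sum_union h

/-- **ENTRY NEAR BUDGET (R54-2).** Split the near block into the TOP shells (where (WG) at the ε₀-free depth `K + D₀`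
gives the weighted deviation energy `≤ v_top`) and the DEEP shells (all at index `≤ −K−D₀`, plain energy `≤ E`, e.g.
the (JB) budget `β(κ/τ)²` plus capture error): `V ≤ v_top + e^{−θ D₀}·E`. No (WG) below depth `K + D₀` is used, so
`N₀ := N_WG(K + D₀, δ₁)` is ε₀-free (ERRATUM-54 to ENTRY-HANDOVER-52 §2, where the depth was written `D`).
[cite: Tao2016AveragedNS, §6.2 Prop. 6.3 (statement shape); cell LADDER §52.2, §54 (L-54c)] -/
theorem entry_near_budget {top deep : Finset ℤ} (hdisj : Disjoint top deep) {θ vtop E : ℝ} {K D₀ : ℕ}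
    (hθ : 0 ≤ θ) (u : Fin 2 → ℤ → ℝ → ℝ) (t : ℝ)
    (htop : MirrorPulse.coMovingEnergyOn top θ (-(K : ℝ)) u t ≤ vtop)
    (hdeep : ∀ n ∈ deep, n ≤ -(K : ℤ) - D₀)
    (hE : ∑ n ∈ deep, (u 0 n t ^ 2 + u 1 n t ^ 2) / 2 ≤ E) :
    MirrorPulse.coMovingEnergyOn (top ∪ deep) θ (-(K : ℝ)) u t ≤ vtop + Real.exp (-(θ * D₀)) * E := by
  rw [coMovingEnergyOn_union hdisj]
  have hs : ∀ n ∈ deep, (n : ℝ) ≤ -(K : ℝ) - D₀ := fun n hn => by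
    have := hdeep n hn; exact_mod_cast this
  have h2 := coMovingEnergyOn_le_exp_mul_energy deep (ne := -(K : ℝ)) hθ u t hs
  have e : θ * (-(K : ℝ) - D₀ - -(K : ℝ)) = -(θ * D₀) := by ring
  rw [e] at h2
  have h3 : Real.exp (-(θ * D₀)) * ∑ n ∈ deep, (u 0 n t ^ 2 + u 1 n t ^ 2) / 2 ≤ Real.exp (-(θ * D₀)) * E :=
    mul_le_mul_of_nonneg_left hE (Real.exp_pos _).le
  linarith

/-- **HOW DEEP IS DEEP ENOUGH**: `D₀ ≥ ln(2E/v)/θ` makes the discounted deep energy `≤ v/2` — with `(E, v, θ)` ε₀-free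
this is the ε₀-free ENTRY depth `D₀`; with `v = 2c·ε₀²` it is the logarithmic NEAR-BLOCK depth `D_near(ε₀)`.
[folklore; cell LADDER §54 (ERRATUM-54, three depths)] -/
theorem deep_discount_le {θ E v D₀ : ℝ} (hθ : 0 < θ) (hE : 0 < E) (hv : 0 < v)
    (hD : Real.log (2 * E / v) / θ ≤ D₀) : Real.exp (-(θ * D₀)) * E ≤ v / 2 := by
  have h1 : Real.log (2 * E / v) ≤ θ * D₀ := by
    have := (div_le_iff₀ hθ).mp hD; linarith
  have h2 : 2 * E / v ≤ Real.exp (θ * D₀) := by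
    calc 2 * E / v = Real.exp (Real.log (2 * E / v)) := (Real.exp_log (by positivity)).symm
      _ ≤ Real.exp (θ * D₀) := Real.exp_le_exp.mpr h1
  have hpos : 0 < Real.exp (θ * D₀) := Real.exp_pos _
  have h4 : 2 * E ≤ Real.exp (θ * D₀) * v := (div_le_iff₀ hv).mp h2
  rw [Real.exp_neg, inv_mul_le_iff₀ hpos]
  linarith

end Summit.NavierStokesRegularity.NavierStokesRegularity.Theorems.HopTube.R54

end
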